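import Mathlib.Analysis.SpecialFunctions.SmoothTransition
import Mathlib.Analysis.SpecialFunctions.Pow.Real
import Mathlib.Analysis.SpecialFunctions.Log.Basic
import Mathlib.Analysis.Calculus.ContDiff.Operations
import HarnessLib

/-!
# The flat reparametrisation `ε = exp(−1/c²)` of polyhomogeneous families

Topic `Literature/Analysis/Calculus`. Gluing theorems for the Einstein constraint equations produce
ONE-SIDED families of data `ε ↦ u(ε, ·)`, `ε ∈ (0, ε₀)`, which are *polyhomogeneous* (log-smooth) in the
gluing parameter: `u(ε, x) = u₀(x) + Σᵢ ε^{aᵢ} (log ε)^{kᵢ} wᵢ(x) + ε·S(ε, x)` with exponents `aᵢ > 0` and a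
remainder `S` of class `C^n` UP TO `ε = 0` (Hintz, arXiv:2210.13960, Thm. 1.2 and Thm. 5.2: the total family
of glued data is a polyhomogeneous section on the total gluing space). Such a family is in general NOT
differentiable at `ε = 0`. The classical remedy ("introduce `e^{-1/ε}` as a new variable", Melrose 1996,
Ch. 4; used by the route `SwallowTheDatum` of the summit `FinalStateConjecture`, item 14721: "reparametrise
`ε = exp(−1/c²)`") is to run the parameter through the flat function `c ↦ exp(−1/c²)`: every term
`ε^a (log ε)^k`, `a > 0`, becomes `exp(−a/c²)(−1/c²)^k`, a `C^∞` function on `ℝ` vanishing to infinite order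
at `c = 0`, and the two-sided family `c ↦ u(exp(−1/c²), ·)` (value `u₀` at `c = 0`) is jointly `C^n`.

This file proves exactly this, over Mathlib's `expNegInvGlue` (`ε(c) := expNegInvGlue (c²) = exp(−1/c²)`
for `c ≠ 0`, `0` at `c = 0`):

* `expNegInvGlue_sq_eq_exp`, `log_expNegInvGlue_sq`, `expNegInvGlue_sq_rpow`, `contDiff_expNegInvGlue_sq`,
  `strictMonoOn_expNegInvGlue_sq`, `exists_expNegInvGlue_sq_eq`, `isOpen_setOf_expNegInvGlue_sq_lt` — the
  reparametrisation: closed forms off `0`, smoothness, strict monotonicity on `[0, ∞)`, every `ε ∈ (0, 1)`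
  is attained, `{c | ε(c) < ε₀}` is an open neighbourhood of `0`;
* `contDiff_flatMonomial` — **`c ↦ ε(c)^a (log ε(c))^k` is `C^∞` on `ℝ`** for real `a > 0` and `k : ℕ`
  (it is `(−a⁻¹)^k · (p(x⁻¹) e^{−1/x})|_{x = c²/a}` with `p = X^k`, Mathlib's
  `expNegInvGlue.contDiff_polynomial_eval_inv_mul`);
* `contDiffOn_flatReparam` — **the reparametrised family is jointly `C^n`**: if
  `u(ε, x) = u₀(x) + Σᵢ ε^{aᵢ}(log ε)^{kᵢ} • wᵢ(x) + ε • S(ε, x)` for `ε ∈ (0, ε₀)`, `x ∈ U` (`U` open), with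
  `aᵢ > 0`, `u₀, wᵢ ∈ C^n(U)` and `S ∈ C^n([0, ε₀) × U)`, then
  `(c, x) ↦ u(ε(c), x)` (`:= u₀ x` at `c = 0`) is `C^n` on `{c | ε(c) < ε₀} × U`;
  `contDiffOn_flatReparam_infty` — with such an expansion for every `n`, it is `C^∞`;
  `contDiffOn_flatReparam_real` — the parameter-only version (`u : ℝ → F`).

Everything is proved (no definitions, no named facts).

## References

* P. Hintz, *Gluing small black holes into initial data sets*, arXiv:2210.13960 (2022), Thm. 1.2, Thm. 5.2
  (polyhomogeneity of the total family in the gluing parameter). [`Hintz2022`]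
* R. B. Melrose, *Differential analysis on manifolds with corners* (1996), Ch. 4 (polyhomogeneous conormal
  functions). [folklore]
-/

noncomputable section

open Set Function Polynomial
open scoped Topology ContDiff

namespace Literature.Analysis.Calculus

/-! ### The reparametrisation `c ↦ expNegInvGlue (c ^ 2) = exp (−1/c²)` -/

/-- Off the origin, `expNegInvGlue (c²) = exp(−(c²)⁻¹)`. [folklore] -/
theorem expNegInvGlue_sq_eq_exp {c : ℝ} (hc : c ≠ 0) :
    expNegInvGlue (c ^ 2) = Real.exp (-(c ^ 2)⁻¹) := by
  have h : ¬ c ^ 2 ≤ 0 := not_le.2 (by positivity)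
  simp [expNegInvGlue, h]

/-- Off the origin, `expNegInvGlue (c²) = exp(−1/c²)`. [folklore] -/
theorem expNegInvGlue_sq_eq_exp_div {c : ℝ} (hc : c ≠ 0) :
    expNegInvGlue (c ^ 2) = Real.exp (-1 / c ^ 2) := by
  rw [expNegInvGlue_sq_eq_exp hc, neg_div, one_div]

/-- At the origin the reparametrisation vanishes. [folklore] -/
@[simp] theorem expNegInvGlue_sq_zero : expNegInvGlue ((0 : ℝ) ^ 2) = 0 := by simp

/-- Off the origin the reparametrisation is positive. [folklore] -/
theorem expNegInvGlue_sq_pos {c : ℝ} (hc : c ≠ 0) : 0 < expNegInvGlue (c ^ 2) :=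
  expNegInvGlue.pos_of_pos (by positivity)

/-- The reparametrisation is nonnegative. [folklore] -/
theorem expNegInvGlue_sq_nonneg (c : ℝ) : 0 ≤ expNegInvGlue (c ^ 2) := expNegInvGlue.nonneg _

/-- The reparametrisation vanishes only at the origin. [folklore] -/
theorem expNegInvGlue_sq_eq_zero_iff {c : ℝ} : expNegInvGlue (c ^ 2) = 0 ↔ c = 0 := by
  rw [expNegInvGlue.zero_iff_nonpos]
  constructor
  · intro h
    by_contra hc
    exact absurd h (not_le.2 (by positivity))
  · rintro rfl; simp

/-- The reparametrisation takes values below `1`. [folklore] -/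
theorem expNegInvGlue_sq_lt_one (c : ℝ) : expNegInvGlue (c ^ 2) < 1 := by
  rcases eq_or_ne c 0 with rfl | hc
  · simp
  · rw [expNegInvGlue_sq_eq_exp hc, Real.exp_lt_one_iff]
    have : 0 < (c ^ 2)⁻¹ := by positivity
    linarith

/-- The reparametrisation is even. [folklore] -/
theorem expNegInvGlue_neg_sq (c : ℝ) : expNegInvGlue ((-c) ^ 2) = expNegInvGlue (c ^ 2) := by
  rw [neg_sq]

/-- The logarithm of the reparametrisation: `log (exp(−1/c²)) = −(c²)⁻¹` off the origin. [folklore] -/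
theorem log_expNegInvGlue_sq {c : ℝ} (hc : c ≠ 0) : Real.log (expNegInvGlue (c ^ 2)) = -(c ^ 2)⁻¹ := by
  rw [expNegInvGlue_sq_eq_exp hc, Real.log_exp]

/-- Real powers of the reparametrisation: `(exp(−1/c²))^a = exp(−a (c²)⁻¹)` off the origin. [folklore] -/
theorem expNegInvGlue_sq_rpow {c : ℝ} (hc : c ≠ 0) (a : ℝ) :
    expNegInvGlue (c ^ 2) ^ a = Real.exp (-(a * (c ^ 2)⁻¹)) := by
  rw [expNegInvGlue_sq_eq_exp hc, ← Real.exp_mul]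
  ring_nf

/-- The reparametrisation is `C^∞` (any order `n`). [folklore] -/
theorem contDiff_expNegInvGlue_sq {n : ℕ∞} : ContDiff ℝ n fun c : ℝ ↦ expNegInvGlue (c ^ 2) :=
  expNegInvGlue.contDiff.comp (contDiff_id.pow 2)

/-- The reparametrisation is continuous. [folklore] -/
theorem continuous_expNegInvGlue_sq : Continuous fun c : ℝ ↦ expNegInvGlue (c ^ 2) :=
  (contDiff_expNegInvGlue_sq (n := 0)).continuous

/-- The reparametrisation is strictly increasing on `[0, ∞)` (hence injective there). [folklore] -/
theorem strictMonoOn_expNegInvGlue_sq : StrictMonoOn (fun c : ℝ ↦ expNegInvGlue (c ^ 2)) (Ici 0) := by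
  intro c hc d hd hcd
  have hd0 : 0 < d := lt_of_le_of_lt hc hcd
  rcases eq_or_lt_of_le (show (0 : ℝ) ≤ c from hc) with h | h
  · simp only [← h]
    simpa using expNegInvGlue_sq_pos hd0.ne'
  · simp only [expNegInvGlue_sq_eq_exp h.ne', expNegInvGlue_sq_eq_exp hd0.ne', Real.exp_lt_exp,
      neg_lt_neg_iff]
    have hc2 : 0 < c ^ 2 := by positivity
    rw [inv_lt_inv₀ (by positivity) hc2]
    exact pow_lt_pow_left₀ hcd hc (by norm_num)

/-- The reparametrisation is injective on `[0, ∞)`. [folklore] -/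
theorem injOn_expNegInvGlue_sq : InjOn (fun c : ℝ ↦ expNegInvGlue (c ^ 2)) (Ici 0) :=
  strictMonoOn_expNegInvGlue_sq.injOn

/-- Every `ε ∈ (0, 1)` is attained by the reparametrisation at the positive parameter `c = (−log ε)^{−1/2}`.
[folklore] -/
theorem exists_expNegInvGlue_sq_eq {ε : ℝ} (hε : 0 < ε) (hε₁ : ε < 1) :
    ∃ c : ℝ, 0 < c ∧ expNegInvGlue (c ^ 2) = ε := by
  have hlog : 0 < -Real.log ε := by
    have := Real.log_neg hε hε₁; linarith
  refine ⟨Real.sqrt ((-Real.log ε)⁻¹), Real.sqrt_pos.2 (inv_pos.2 hlog), ?_⟩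
  have hne : Real.sqrt ((-Real.log ε)⁻¹) ≠ 0 := (Real.sqrt_pos.2 (inv_pos.2 hlog)).ne'
  rw [expNegInvGlue_sq_eq_exp hne, Real.sq_sqrt (inv_pos.2 hlog).le, inv_inv, neg_neg, Real.exp_log hε]

/-- The sub-level sets `{c | ε(c) < ε₀}` of the reparametrisation are open … [folklore] -/
theorem isOpen_setOf_expNegInvGlue_sq_lt (ε₀ : ℝ) : IsOpen {c : ℝ | expNegInvGlue (c ^ 2) < ε₀} :=
  isOpen_lt continuous_expNegInvGlue_sq continuous_const

/-- … and contain the origin as soon as `ε₀ > 0`. [folklore] -/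
theorem zero_mem_setOf_expNegInvGlue_sq_lt {ε₀ : ℝ} (hε₀ : 0 < ε₀) :
    (0 : ℝ) ∈ {c : ℝ | expNegInvGlue (c ^ 2) < ε₀} := by
  simpa using hε₀

/-- For `ε₀ > 0` the sub-level set `{c | ε(c) < ε₀}` is a neighbourhood of the origin. [folklore] -/
theorem setOf_expNegInvGlue_sq_lt_mem_nhds {ε₀ : ℝ} (hε₀ : 0 < ε₀) :
    {c : ℝ | expNegInvGlue (c ^ 2) < ε₀} ∈ 𝓝 (0 : ℝ) :=
  (isOpen_setOf_expNegInvGlue_sq_lt ε₀).mem_nhds (zero_mem_setOf_expNegInvGlue_sq_lt hε₀)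

/-- If `ε₀ ≥ 1` the sub-level set is everything. [folklore] -/
theorem setOf_expNegInvGlue_sq_lt_eq_univ {ε₀ : ℝ} (hε₀ : 1 ≤ ε₀) :
    {c : ℝ | expNegInvGlue (c ^ 2) < ε₀} = univ :=
  eq_univ_of_forall fun c ↦ lt_of_lt_of_le (expNegInvGlue_sq_lt_one c) hε₀

/-! ### Flat monomials `ε(c)^a (log ε(c))^k` -/

/-- **The flat monomials are smooth.** For real `a > 0` and `k : ℕ` the function
`c ↦ ε(c)^a (log ε(c))^k` (`= exp(−a/c²)(−1/c²)^k` off `0`, `= 0` at `0`; `ε(c) = expNegInvGlue (c²)`) is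
`C^∞` on `ℝ`: it equals `(−a⁻¹)^k · (p(x⁻¹) e^{−1/x})|_{x = c²/a}` with `p = X^k`. Melrose 1996, Ch. 4 (the
model computation behind "polyhomogeneous in `ε` ⇒ smooth in `e^{−1/ε}`-type variables"). [folklore] -/
theorem contDiff_flatMonomial {n : ℕ∞} {a : ℝ} (ha : 0 < a) (k : ℕ) :
    ContDiff ℝ n fun c : ℝ ↦ expNegInvGlue (c ^ 2) ^ a * Real.log (expNegInvGlue (c ^ 2)) ^ k := by
  have hmodel : ContDiff ℝ n fun c : ℝ ↦
      (-a⁻¹) ^ k * ((X ^ k : ℝ[X]).eval (c ^ 2 / a)⁻¹ * expNegInvGlue (c ^ 2 / a)) :=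
    contDiff_const.mul ((expNegInvGlue.contDiff_polynomial_eval_inv_mul (X ^ k)).comp
      ((contDiff_id.pow 2).div_const a))
  have heq : (fun c : ℝ ↦ expNegInvGlue (c ^ 2) ^ a * Real.log (expNegInvGlue (c ^ 2)) ^ k) =
      fun c : ℝ ↦ (-a⁻¹) ^ k * ((X ^ k : ℝ[X]).eval (c ^ 2 / a)⁻¹ * expNegInvGlue (c ^ 2 / a)) := by
    funext c
    rcases eq_or_ne c 0 with rfl | hc
    · simp [Real.zero_rpow ha.ne']
    · have hc2 : c ^ 2 ≠ 0 := pow_ne_zero 2 hc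
      have hpos : ¬ c ^ 2 / a ≤ 0 := not_le.2 (by positivity)
      rw [expNegInvGlue_sq_rpow hc, log_expNegInvGlue_sq hc]
      simp only [eval_pow, eval_X, expNegInvGlue, hpos, if_false, inv_div]
      rw [show Real.exp (-(a * (c ^ 2)⁻¹)) = Real.exp (-(a / c ^ 2)) by rw [div_eq_mul_inv]]
      have : (-(c ^ 2)⁻¹) ^ k = (-a⁻¹) ^ k * (a / c ^ 2) ^ k := by
        rw [← mul_pow]; congr 1; field_simp
      rw [this]; ring
  rw [heq]
  exact hmodel

/-- The flat monomial with `k = 0`: `c ↦ ε(c)^a = exp(−a/c²)` is `C^∞` for `a > 0`. [folklore] -/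
theorem contDiff_expNegInvGlue_sq_rpow {n : ℕ∞} {a : ℝ} (ha : 0 < a) :
    ContDiff ℝ n fun c : ℝ ↦ expNegInvGlue (c ^ 2) ^ a := by
  simpa using contDiff_flatMonomial (n := n) ha 0

/-- The flat monomials vanish at the origin (`a > 0`). [folklore] -/
theorem flatMonomial_zero {a : ℝ} (ha : 0 < a) (k : ℕ) :
    expNegInvGlue ((0 : ℝ) ^ 2) ^ a * Real.log (expNegInvGlue ((0 : ℝ) ^ 2)) ^ k = 0 := by
  simp [Real.zero_rpow ha.ne']

/-! ### The reparametrised family is jointly `C^n` -/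

section Family

variable {E F : Type*} [NormedAddCommGroup E] [NormedSpace ℝ E] [NormedAddCommGroup F] [NormedSpace ℝ F]

/-- **Flat reparametrisation of a polyhomogeneous family (joint version).** Let `U ⊆ E` be open and let
`u : ℝ → E → F` have, for `ε ∈ (0, ε₀)` and `x ∈ U`, the expansion
`u ε x = u₀ x + Σᵢ (ε^{aᵢ} (log ε)^{kᵢ}) • wᵢ x + ε • S ε x` with finitely many real exponents `aᵢ > 0`,
`kᵢ : ℕ`, coefficients `u₀, wᵢ` of class `C^n` on `U` and a remainder `S` of class `C^n` on `[0, ε₀) × U`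
(jointly, up to `ε = 0`). Then the two-sided family `(c, x) ↦ u (ε(c)) x`, `ε(c) = expNegInvGlue (c²) =
exp(−1/c²)`, extended by `u₀ x` at `c = 0`, is of class `C^n` on the open set `{c | ε(c) < ε₀} × U` (a
neighbourhood of `{0} × U` when `ε₀ > 0`). Proof: on that set it equals
`u₀ x + Σᵢ mᵢ(c) • wᵢ x + ε(c) • S (ε(c)) x` with the smooth flat monomials `mᵢ` of
`contDiff_flatMonomial`. Hintz arXiv:2210.13960, Thm. 1.2 (the families this is designed for); Melrose 1996,
Ch. 4. [folklore] -/
theorem contDiffOn_flatReparam {n : ℕ} {U : Set E} (hU : IsOpen U) {ε₀ : ℝ} {u : ℝ → E → F} {u₀ : E → F}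
    {ι : Type*} [Fintype ι] {a : ι → ℝ} {k : ι → ℕ} {w : ι → E → F} {S : ℝ → E → F}
    (ha : ∀ i, 0 < a i) (hu₀ : ContDiffOn ℝ n u₀ U) (hw : ∀ i, ContDiffOn ℝ n (w i) U)
    (hS : ContDiffOn ℝ n (uncurry S) (Ico 0 ε₀ ×ˢ U))
    (hexp : ∀ ε ∈ Ioo 0 ε₀, ∀ x ∈ U,
      u ε x = u₀ x + ∑ i, (ε ^ (a i) * Real.log ε ^ (k i)) • w i x + ε • S ε x) :
    ContDiffOn ℝ n (fun p : ℝ × E ↦ if p.1 = 0 then u₀ p.2 else u (expNegInvGlue (p.1 ^ 2)) p.2)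
      ({c : ℝ | expNegInvGlue (c ^ 2) < ε₀} ×ˢ U) := by
  have _ := hU
  set V : Set (ℝ × E) := {c : ℝ | expNegInvGlue (c ^ 2) < ε₀} ×ˢ U with hV
  -- the smooth model
  set G : ℝ × E → F := fun p ↦ u₀ p.2 +
      ∑ i, (expNegInvGlue (p.1 ^ 2) ^ (a i) * Real.log (expNegInvGlue (p.1 ^ 2)) ^ (k i)) • w i p.2 +
      expNegInvGlue (p.1 ^ 2) • S (expNegInvGlue (p.1 ^ 2)) p.2 with hG
  have hsnd : MapsTo (fun p : ℝ × E ↦ p.2) V U := fun p hp ↦ hp.2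
  have hGs : ContDiffOn ℝ n G V := by
    refine ContDiffOn.add (ContDiffOn.add ?_ ?_) ?_
    · exact hu₀.comp contDiffOn_snd hsnd
    · refine ContDiffOn.sum fun i _ ↦ ContDiffOn.smul ?_ ((hw i).comp contDiffOn_snd hsnd)
      exact ((contDiff_flatMonomial (n := n) (ha i) (k i)).comp contDiff_fst).contDiffOn
    · refine ContDiffOn.smul ((contDiff_expNegInvGlue_sq (n := n)).comp contDiff_fst).contDiffOn ?_
      have hmap : MapsTo (fun p : ℝ × E ↦ (expNegInvGlue (p.1 ^ 2), p.2)) V (Ico 0 ε₀ ×ˢ U) :=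
        fun p hp ↦ ⟨⟨expNegInvGlue_sq_nonneg _, hp.1⟩, hp.2⟩
      have hin : ContDiffOn ℝ n (fun p : ℝ × E ↦ (expNegInvGlue (p.1 ^ 2), p.2)) V :=
        (((contDiff_expNegInvGlue_sq (n := n)).comp contDiff_fst).prodMk contDiff_snd).contDiffOn
      exact hS.comp hin hmap
  refine hGs.congr fun p hp ↦ ?_
  rcases eq_or_ne p.1 0 with h0 | h0
  · simp [hG, h0, Real.zero_rpow (ha _).ne']
  · have hε : expNegInvGlue (p.1 ^ 2) ∈ Ioo 0 ε₀ := ⟨expNegInvGlue_sq_pos h0, hp.1⟩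
    simp only [h0, if_false, hG]
    exact hexp _ hε _ hp.2

/-- **Flat reparametrisation, `C^∞` version.** If the one-sided family `u` admits, for EVERY `n`, an expansion
as in `contDiffOn_flatReparam` with `C^n` pieces (the exponents, coefficients and remainder may depend on
`n` — as they do for a polyhomogeneous family, whose remainder after the terms of order `< N` is as regular up
to `ε = 0` as one wishes for `N` large), then the reparametrised two-sided family is `C^∞` on
`{c | ε(c) < ε₀} × U`. [folklore] -/
theorem contDiffOn_flatReparam_infty {U : Set E} (hU : IsOpen U) {ε₀ : ℝ} {u : ℝ → E → F} {u₀ : E → F}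
    (h : ∀ n : ℕ, ∃ (m : ℕ) (a : Fin m → ℝ) (k : Fin m → ℕ) (w : Fin m → E → F) (S : ℝ → E → F),
      (∀ i, 0 < a i) ∧ ContDiffOn ℝ n u₀ U ∧ (∀ i, ContDiffOn ℝ n (w i) U) ∧
      ContDiffOn ℝ n (uncurry S) (Ico 0 ε₀ ×ˢ U) ∧
      ∀ ε ∈ Ioo 0 ε₀, ∀ x ∈ U,
        u ε x = u₀ x + ∑ i, (ε ^ (a i) * Real.log ε ^ (k i)) • w i x + ε • S ε x) :
    ContDiffOn ℝ ∞ (fun p : ℝ × E ↦ if p.1 = 0 then u₀ p.2 else u (expNegInvGlue (p.1 ^ 2)) p.2)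
      ({c : ℝ | expNegInvGlue (c ^ 2) < ε₀} ×ˢ U) := by
  rw [contDiffOn_infty]
  intro n
  obtain ⟨m, a, k, w, S, ha, hu₀, hw, hS, hexp⟩ := h n
  exact contDiffOn_flatReparam hU ha hu₀ hw hS hexp

/-- **Flat reparametrisation without logarithmic/fractional terms** (a family `u ε x = u₀ x + ε • S ε x` with
`S ∈ C^n([0, ε₀) × U)`, e.g. a family smooth up to `ε = 0`): the reparametrised two-sided family is `C^n`.
[folklore] -/
theorem contDiffOn_flatReparam_of_remainder {n : ℕ} {U : Set E} (hU : IsOpen U) {ε₀ : ℝ}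
    {u : ℝ → E → F} {u₀ : E → F} {S : ℝ → E → F} (hu₀ : ContDiffOn ℝ n u₀ U)
    (hS : ContDiffOn ℝ n (uncurry S) (Ico 0 ε₀ ×ˢ U))
    (hexp : ∀ ε ∈ Ioo 0 ε₀, ∀ x ∈ U, u ε x = u₀ x + ε • S ε x) :
    ContDiffOn ℝ n (fun p : ℝ × E ↦ if p.1 = 0 then u₀ p.2 else u (expNegInvGlue (p.1 ^ 2)) p.2)
      ({c : ℝ | expNegInvGlue (c ^ 2) < ε₀} ×ˢ U) :=
  contDiffOn_flatReparam (ι := Fin 0) (a := fun _ ↦ 1) (k := fun _ ↦ 0) (w := fun _ _ ↦ 0) hU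
    (fun _ ↦ one_pos) hu₀ (fun _ ↦ contDiffOn_const) hS (by simpa using hexp)

/-- **Flat reparametrisation, parameter-only version.** A one-sided curve `u : ℝ → F` with
`u ε = u₀ + Σᵢ (ε^{aᵢ} (log ε)^{kᵢ}) • wᵢ + ε • S ε` on `(0, ε₀)` (`aᵢ > 0`, `S ∈ C^n([0, ε₀))`) becomes,
after `ε = exp(−1/c²)` and extension by `u₀` at `c = 0`, a `C^n` curve on `{c | ε(c) < ε₀}`. [folklore] -/
theorem contDiffOn_flatReparam_real {n : ℕ} {ε₀ : ℝ} {u : ℝ → F} {u₀ : F}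
    {ι : Type*} [Fintype ι] {a : ι → ℝ} {k : ι → ℕ} {w : ι → F} {S : ℝ → F}
    (ha : ∀ i, 0 < a i) (hS : ContDiffOn ℝ n S (Ico 0 ε₀))
    (hexp : ∀ ε ∈ Ioo 0 ε₀, u ε = u₀ + ∑ i, (ε ^ (a i) * Real.log ε ^ (k i)) • w i + ε • S ε) :
    ContDiffOn ℝ n (fun c : ℝ ↦ if c = 0 then u₀ else u (expNegInvGlue (c ^ 2)))
      {c : ℝ | expNegInvGlue (c ^ 2) < ε₀} := by
  -- run the joint version with a dummy space variable and restrict to the slice `x = 0`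
  have hj := contDiffOn_flatReparam (E := ℝ) (F := F) (U := univ) (u := fun ε _ ↦ u ε) (u₀ := fun _ ↦ u₀)
    (w := fun i _ ↦ w i) (S := fun ε _ ↦ S ε) isOpen_univ ha contDiffOn_const (fun _ ↦ contDiffOn_const)
    ((hS.comp contDiffOn_fst (fun p hp ↦ hp.1)).congr fun _ _ ↦ rfl) (fun ε hε _ _ ↦ hexp ε hε)
  have hemb : ContDiffOn ℝ n (fun c : ℝ ↦ (c, (0 : ℝ))) {c : ℝ | expNegInvGlue (c ^ 2) < ε₀} :=
    (contDiff_id.prodMk contDiff_const).contDiffOn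
  have hmap : MapsTo (fun c : ℝ ↦ (c, (0 : ℝ))) {c : ℝ | expNegInvGlue (c ^ 2) < ε₀}
      ({c : ℝ | expNegInvGlue (c ^ 2) < ε₀} ×ˢ (univ : Set ℝ)) := fun c hc ↦ ⟨hc, mem_univ _⟩
  exact (hj.comp hemb hmap).congr fun c _ ↦ rfl

end Family

end Literature.Analysis.Calculus

end
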